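import Summits.BirchSwinnertonDyer.Rank1Residual.GaloisImage.KatoZetaValueEquivariance
import Summits.BirchSwinnertonDyer.Rank1Residual.GaloisImage.CyclotomicGroupRingEvaluation
import HarnessLib

/-!
# Kato's value datum under a complex conjugation of the level: `Λ(y + g₋·y) = (1 + 1 ⊗ σ₋₁)(Λ y)`
# (sub-target T-PK-PAR (T⁺2) of r1 R1-72 (B), in PK-1's currency; cell `b2b-bsdres`, team n1011,
# ROUTE-1 PORT (P-KIM); seat p02 GEN 12 — PK-1 lineage)

HONEST FRAMING (cell `b2b-bsdres`, run/shared/lean/b2b/bsd-rank1-residual/, verbatim in every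
file): the goal of the cell is to DELETE the COMBINATION-SHAPED residual classes of the
Birch–Swinnerton-Dyer formula for ALL analytic-rank `≤ 1` elliptic curves over `ℚ` — "full BSD
formula for every rank `≤ 1` curve in class `C`" assembled STRICTLY from published theorems — so
that the rank-`≤ 1` remainder becomes exactly the CONSTRUCTION-SHAPED classes, which are TYPED
(missing-input `Prop`s), NOT attempted. This is not "finishing BSD". Team n1011 (N10/N11; ROUTE 1,
the PORT anatomy (P-KIM) of class X4 ∧ `p = 3`): research route on CONSTRUCTION-SHAPED classes;
prove what is provable now; no claim beyond stated classes; census output = EVIDENCE, never a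
Literature fact; RESIDUAL-MAP marks UNCHANGED; nothing is booked by this file. TOOL THEOREMS ONLY:
no definition, no named fact, no instance, no `sorry`; the Kato fact `ZetaBody` enters as a
displayed HYPOTHESIS `hbody`, never asserted.

## What (r1 ROUTE-1 §56.3 (B) "PARITY — the odd part dies without integrality")

R1-72 (B) symmetrises THEOREM A's derivative class by an element `g₋` of the absolute Galois group
acting on `ℚ(ζ_m)` as complex conjugation (`χ_m(g₋) = −1`, THEOREM A3's `∏_ℓ σ̃_ℓ^{(ℓ−1)/2}`):
`y⁺ := y + g₋·y`, `y = D_r · z_{0,r}`.  This file is the VALUE side of that move, in the currency of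
PK-1 (`ZetaValue.*`) and with `χ_m(g₋) = −1` a DISPLAYED hypothesis `hg` (it is a statement about
THEOREM A3's concrete generators, discharged by the PK-6 assembler — p13's (T⁺1) file):

* `zetaBody_apply_conjMap` — `ZetaBody` (C3a) as a projection:
  `Λ_{k,r}(g·y) = (1 ⊗ σ_{χ_m(g)})(Λ_{k,r} y)`;
* `zetaBody_apply_add_conjMap` — `Λ_{k,r}(y + g·y) = Λ_{k,r} y + (1 ⊗ σ_{χ_m(g)})(Λ_{k,r} y)`, and with
  `hg : χ_m(g) = −1`: `… = Λ y + (1 ⊗ σ₋₁)(Λ y)` (`zetaBody_apply_add_conjMap_of_eq_neg_one`);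
* ★ `zetaBody_apply_deriv_zeta_add_conjMap_eq_tmul` — with PK-1 ★2: for `y = D · z_{k,r}`,
  `Λ_{k,r}(D·z + g₋·(D·z)) = 1 ⊗ (D^{field} x_{k,r} + σ₋₁(D^{field} x_{k,r}))` — the `y⁺`-value is the
  pure tensor of the PLUS-symmetrised field element, the input of PK-5 (ii)'s `hval` for `y⁺`;
* `sigma_fieldDeriv_comm` — `σ_h ∘ D^{field} = D^{field} ∘ σ_h` (so the symmetrisation may be moved onto
  `x` itself: `… = 1 ⊗ D^{field}(x + σ₋₁ x)`, `zetaBody_apply_deriv_zeta_add_conjMap_eq_tmul_deriv`);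
* `sigma_sum_coeff_smul_sigma` (group-ring side, T-PKEV E-A currency) — `σ_h(Σ_g Y_g • σ_g z) =
  Σ_g (δ_h · Y)_g • σ_g z`: the symmetrisation `1 + σ₋₁` of a value is the evaluation of `(1 + δ₋₁)·Y`;
* `eq_neg_one_of_forall_castHom_eq_neg_one` — CRT: an element of `ℤ/n` (`n` square-free) that is `−1`
  modulo every prime of `n` is `−1` (the arithmetic half of `χ_n(g₋) = −1`; the Galois half — each
  `σ̃_ℓ` is `≡ 1 (mod n/ℓ)` of exact order `ℓ − 1 (mod ℓ)` — is THEOREM A3's datum, (T⁺1)'s file).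

HONEST LIMITS: no claim that any particular `g` has `χ_m(g) = −1` (that is (T⁺1)'s / THEOREM A3's
datum); nothing about classes, `exp*`, lattices or Kolyvagin systems; closes nothing; books nothing;
0 defs / 0 facts.

References: K. Kato, Astérisque 295 (2004) §9.4 p. 188, Thm. 9.7 p. 189 [Kato2004Asterisque];
K. Rubin, *Euler Systems* (2000) Def. 4.4.1 [Rubin2000]; design `cells/n1011/ROUTE-1.md` §56.3 (B)
R1-72 (r1 GEN 44), p13 GEN 13 / p15 GEN 9 adoptions (cell INBOX 07:55Z / 08:00Z).
-/

noncomputable section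

open CategoryTheory
open scoped BigOperators NumberField TensorProduct
open Field IsDedekindDomain CongruenceSubgroup

namespace Summit.BirchSwinnertonDyer.Rank1Residual.GaloisImage.ZetaValue

open Literature.NumberTheory.GaloisRepresentations Literature.NumberTheory.EllipticCurves
  Literature.NumberTheory.EllipticCurves.ModularForms
  Literature.NumberTheory.EllipticCurves.Kato2004
  Literature.NumberTheory.EllipticCurves.Kato2004.EulerSystemValues Rat.HeightOneSpectrum

/-! ### §1 Field side: `σ_h` commutes with the derivative operator; translation on the group ring -/

/-- **`σ_h` commutes with the field-level derivative operator** `∏_{i∈s} Σ_{j<N_i} j·σ_{b_i}^j`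
(`Gal(ℚ(ζ_m)/ℚ)` is abelian). [folklore] -/
theorem sigma_fieldDeriv_comm (m : ℕ) [NeZero m] {ι' : Type*} (b : ι' → (ZMod m)ˣ) (Nℓ : ι' → ℕ)
    (s : Finset ι') (comm) (h : (ZMod m)ˣ) (w : CyclotomicField m ℚ) :
    sigma m h (s.noncommProd (fun i => ∑ j ∈ Finset.range (Nℓ i),
        (j : Module.End ℚ (CyclotomicField m ℚ)) *
          (sigma m (b i) : CyclotomicField m ℚ →ₐ[ℚ] CyclotomicField m ℚ).toLinearMap ^ j) comm w) =
      s.noncommProd (fun i => ∑ j ∈ Finset.range (Nℓ i),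
        (j : Module.End ℚ (CyclotomicField m ℚ)) *
          (sigma m (b i) : CyclotomicField m ℚ →ₐ[ℚ] CyclotomicField m ℚ).toLinearMap ^ j) comm
        (sigma m h w) :=
  addMonoidHom_apply_noncommProd_deriv
    ((sigma m h : CyclotomicField m ℚ →ₐ[ℚ] CyclotomicField m ℚ).toLinearMap.toAddMonoidHom)
    (fun i => (sigma m (b i) : CyclotomicField m ℚ →ₐ[ℚ] CyclotomicField m ℚ).toLinearMap)
    (fun i => (sigma m (b i) : CyclotomicField m ℚ →ₐ[ℚ] CyclotomicField m ℚ).toLinearMap) Nℓ s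
    (fun i _ v => sigma_comm_apply m h (b i) v) comm comm w

/-- **Translation on the group ring**: `σ_h(Σ_g Y_g • σ_g z) = Σ_g (δ_h·Y)_g • σ_g z` (T-PKEV E-A
currency; the symmetrisation `w + σ₋₁ w` of a value is the value of `(1 + δ₋₁)·Y`). [folklore] -/
theorem sigma_sum_coeff_smul_sigma (m : ℕ) [NeZero m] (h : (ZMod m)ˣ) (Y : MonoidAlgebra ℚ (ZMod m)ˣ)
    (z : CyclotomicField m ℚ) :
    sigma m h (∑ g : (ZMod m)ˣ, Y.coeff g • sigma m g z) =
      ∑ g : (ZMod m)ˣ, (MonoidAlgebra.single h (1 : ℚ) * Y).coeff g • sigma m g z := by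
  rw [GroupRingEval.sum_coeff_mul_smul_sigma, GroupRingEval.sum_coeff_single_smul_sigma, one_smul]

/-- **CRT for the sign**: an element of `ℤ/n`, `n` square-free, which is `−1` modulo every prime of
`n` is `−1` — the arithmetic half of `χ_n(g₋) = −1` for THEOREM A3's `g₋ = ∏_ℓ σ̃_ℓ^{(ℓ−1)/2}`
(each factor `≡ −1 (mod ℓ)`, `≡ 1 (mod n/ℓ)`; p13's (T⁺1) file supplies that). [folklore] -/
theorem eq_neg_one_of_forall_castHom_eq_neg_one (n : ℕ) [NeZero n] (hn : Squarefree n) (u : ZMod n)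
    (h : ∀ (ℓ : ℕ) (hℓ : ℓ ∈ n.primeFactors),
      ZMod.castHom (Nat.dvd_of_mem_primeFactors hℓ) (ZMod ℓ) u = -1) : u = -1 := by
  rw [← add_eq_zero_iff_eq_neg]
  -- every prime of `n` divides the representative of `u + 1`, hence `n` does
  have hdvd : ∀ ℓ ∈ n.primeFactors, ℓ ∣ (u + 1).val := by
    intro ℓ hℓ
    have hℓ0 := h ℓ hℓ
    have : ZMod.castHom (Nat.dvd_of_mem_primeFactors hℓ) (ZMod ℓ) (u + 1) = 0 := by
      rw [map_add, hℓ0, map_one, neg_add_cancel]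
    rw [ZMod.castHom_apply, ZMod.cast_eq_val, ZMod.natCast_eq_zero_iff] at this
    exact this
  have hn' : n ∣ (u + 1).val := by
    have hprod := Finset.prod_primes_dvd _ (fun ℓ hℓ => (Nat.prime_of_mem_primeFactors hℓ).prime) hdvd
    rwa [Nat.prod_primeFactors_of_squarefree hn] at hprod
  have hval : (u + 1).val = 0 := Nat.eq_zero_of_dvd_of_lt hn' (ZMod.val_lt _)
  exact (ZMod.val_eq_zero _).mp hval

/-! ### §2 Kato's value datum under a conjugation of the level -/

section Zeta

variable (W : WeierstrassCurve ℚ) [W.IsElliptic] (p : ℕ) [Fact p.Prime]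
  [ContinuousSMul ℤ_[p] (W.tateModule p)] [Module.Free ℤ_[p] (W.tateModule p)]
  [Module.Finite ℤ_[p] (W.tateModule p)] {N : ℕ} (f : CuspForm (Gamma0 N) 2)
  (ι : (m : ℕ) → (CyclotomicField m ℚ →+* ℂ)) (κ : ℝ)
  (Λ : ∀ (k : ℕ) (r : Finset (HeightOneSpectrum (𝓞 ℚ))),
    H1 (tateRep W p) (cycSubgroup p k r) →ₗ[ℤ_[p]] ℚ_[p] ⊗[ℚ] CyclotomicField (cycLevel p k r) ℚ)
  (c d a : ℤ) (A : ℕ)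
  (z : ∀ (k : ℕ) (r : (cyclotomicLevelsRat p (badPlaces c d A N)).Ideals),
    H1 (tateRep W p) ((cyclotomicLevelsRat p (badPlaces c d A N)).level k r.1))
  (x : ∀ (k : ℕ) (r : (cyclotomicLevelsRat p (badPlaces c d A N)).Ideals),
    CyclotomicField (cycLevel p k r.1) ℚ)

/-- **(C3a) as a projection**: `Λ_{k,r}(g·y) = (1 ⊗ σ_{χ_m(g)})(Λ_{k,r} y)` for every `g` in the
absolute Galois group (acting on `H¹` by `conjMap`). [cite: Kato2004Asterisque, §9.4 (p. 188)] -/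
theorem zetaBody_apply_conjMap (hbody : ZetaBody W p f ι κ Λ c d a A z x) (k : ℕ)
    (r : Finset (HeightOneSpectrum (𝓞 ℚ))) (g : absoluteGaloisGroup ℚ)
    (y : H1 (tateRep W p) (cycSubgroup p k r)) :
    Λ k r (conjMap (tateRep W p).toTopRep (cycSubgroup p k r) g 1 y) =
      Algebra.TensorProduct.map (AlgHom.id ℚ ℚ_[p])
        (sigma (cycLevel p k r) (modNCyclotomicCharacter ℚ (cycLevel p k r) g) :
          CyclotomicField (cycLevel p k r) ℚ →ₐ[ℚ] CyclotomicField (cycLevel p k r) ℚ) (Λ k r y) := by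
  obtain ⟨-, -, h3a, -, -, -⟩ := hbody
  exact h3a k r g y

/-- **`Λ(y + g·y) = Λ y + (1 ⊗ σ_{χ_m(g)})(Λ y)`.** [cite: Kato2004Asterisque, §9.4 (p. 188)] -/
theorem zetaBody_apply_add_conjMap (hbody : ZetaBody W p f ι κ Λ c d a A z x) (k : ℕ)
    (r : Finset (HeightOneSpectrum (𝓞 ℚ))) (g : absoluteGaloisGroup ℚ)
    (y : H1 (tateRep W p) (cycSubgroup p k r)) :
    Λ k r (y + conjMap (tateRep W p).toTopRep (cycSubgroup p k r) g 1 y) =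
      Λ k r y + Algebra.TensorProduct.map (AlgHom.id ℚ ℚ_[p])
        (sigma (cycLevel p k r) (modNCyclotomicCharacter ℚ (cycLevel p k r) g) :
          CyclotomicField (cycLevel p k r) ℚ →ₐ[ℚ] CyclotomicField (cycLevel p k r) ℚ) (Λ k r y) := by
  rw [map_add, zetaBody_apply_conjMap W p f ι κ Λ c d a A z x hbody]

/-- **The symmetrised value**: if `g₋` acts on `ℚ(ζ_m)` as complex conjugation (`χ_m(g₋) = −1`,
displayed — THEOREM A3's `∏_ℓ σ̃_ℓ^{(ℓ−1)/2}` per r1 R1-72 (B)), then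
`Λ(y + g₋·y) = Λ y + (1 ⊗ σ₋₁)(Λ y)`. [cite: Kato2004Asterisque, §9.4 (p. 188)] -/
theorem zetaBody_apply_add_conjMap_of_eq_neg_one (hbody : ZetaBody W p f ι κ Λ c d a A z x) (k : ℕ)
    (r : Finset (HeightOneSpectrum (𝓞 ℚ))) {g : absoluteGaloisGroup ℚ}
    (hg : modNCyclotomicCharacter ℚ (cycLevel p k r) g = -1)
    (y : H1 (tateRep W p) (cycSubgroup p k r)) :
    Λ k r (y + conjMap (tateRep W p).toTopRep (cycSubgroup p k r) g 1 y) =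
      Λ k r y + Algebra.TensorProduct.map (AlgHom.id ℚ ℚ_[p])
        (sigma (cycLevel p k r) (-1) :
          CyclotomicField (cycLevel p k r) ℚ →ₐ[ℚ] CyclotomicField (cycLevel p k r) ℚ) (Λ k r y) := by
  rw [zetaBody_apply_add_conjMap W p f ι κ Λ c d a A z x hbody, hg]

/-- **★ (T⁺2) The value of the symmetrised derivative class is a pure tensor:**
`Λ_{k,r}(D·z_{k,r} + g₋·(D·z_{k,r})) = 1 ⊗ (D^{field} x_{k,r} + σ₋₁(D^{field} x_{k,r}))`, `D` THEOREM A3's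
derivative operator (PK-1 ★2 `zetaBody_apply_deriv_zeta_eq_tmul`), `χ_m(g₋) = −1` displayed.  This is
the `y⁺`-value that PK-5 (ii)'s `hval` receives under r1 R1-72 (B).
[cite: Kato2004Asterisque, Thm. 9.7 (p. 189) and §9.4 (p. 188)] -/
theorem zetaBody_apply_deriv_zeta_add_conjMap_eq_tmul (hbody : ZetaBody W p f ι κ Λ c d a A z x)
    (k : ℕ) (r : (cyclotomicLevelsRat p (badPlaces c d A N)).Ideals)
    {ι' : Type*} (σ : ι' → absoluteGaloisGroup ℚ) (Nℓ : ι' → ℕ) (s : Finset ι') (comm)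
    {g : absoluteGaloisGroup ℚ} (hg : modNCyclotomicCharacter ℚ (cycLevel p k r.1) g = -1) :
    Λ k r.1 (s.noncommProd (fun ℓ => ∑ j ∈ Finset.range (Nℓ ℓ),
        (j : Module.End ℤ_[p] (H1 (tateRep W p) (cycSubgroup p k r.1))) *
          (conjMap (tateRep W p).toTopRep (cycSubgroup p k r.1) (σ ℓ) 1).hom.toLinearMap ^ j) comm
            (z k r) +
        conjMap (tateRep W p).toTopRep (cycSubgroup p k r.1) g 1
          (s.noncommProd (fun ℓ => ∑ j ∈ Finset.range (Nℓ ℓ),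
            (j : Module.End ℤ_[p] (H1 (tateRep W p) (cycSubgroup p k r.1))) *
              (conjMap (tateRep W p).toTopRep (cycSubgroup p k r.1) (σ ℓ) 1).hom.toLinearMap ^ j) comm
                (z k r))) =
      (1 : ℚ_[p]) ⊗ₜ[ℚ]
        ((s.noncommProd (fun ℓ => ∑ j ∈ Finset.range (Nℓ ℓ),
            (j : Module.End ℚ (CyclotomicField (cycLevel p k r.1) ℚ)) *
              (sigma (cycLevel p k r.1) (modNCyclotomicCharacter ℚ (cycLevel p k r.1) (σ ℓ)) :
                CyclotomicField (cycLevel p k r.1) ℚ →ₐ[ℚ]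
                  CyclotomicField (cycLevel p k r.1) ℚ).toLinearMap ^ j)
            (pairwise_commute_fieldDeriv (cycLevel p k r.1)
              (fun ℓ => modNCyclotomicCharacter ℚ (cycLevel p k r.1) (σ ℓ)) Nℓ s) (x k r)) +
          sigma (cycLevel p k r.1) (-1)
            ((s.noncommProd (fun ℓ => ∑ j ∈ Finset.range (Nℓ ℓ),
              (j : Module.End ℚ (CyclotomicField (cycLevel p k r.1) ℚ)) *
                (sigma (cycLevel p k r.1) (modNCyclotomicCharacter ℚ (cycLevel p k r.1) (σ ℓ)) :
                  CyclotomicField (cycLevel p k r.1) ℚ →ₐ[ℚ]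
                    CyclotomicField (cycLevel p k r.1) ℚ).toLinearMap ^ j)
              (pairwise_commute_fieldDeriv (cycLevel p k r.1)
                (fun ℓ => modNCyclotomicCharacter ℚ (cycLevel p k r.1) (σ ℓ)) Nℓ s) (x k r)))) := by
  rw [zetaBody_apply_add_conjMap_of_eq_neg_one W p f ι κ Λ c d a A z x hbody k r.1 hg,
    zetaBody_apply_deriv_zeta_eq_tmul W p f ι κ Λ c d a A z x hbody k r σ Nℓ s comm,
    Algebra.TensorProduct.map_tmul, AlgHom.coe_id, id_eq, TensorProduct.tmul_add]
  rfl

/-- **★ (T⁺2), symmetrisation moved onto `x`**: `Λ_{k,r}(D·z + g₋·(D·z)) = 1 ⊗ D^{field}(x_{k,r} + σ₋₁ x_{k,r})`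
(`σ₋₁` commutes with `D^{field}`, `sigma_fieldDeriv_comm`) — with T-PKEV E-D's avatar `X` of `x_{k,r}`
and `sigma_sum_coeff_smul_sigma`, the argument of `D^{field}` is the value of `(1 + δ₋₁)·X`.
[cite: Kato2004Asterisque, Thm. 9.7 (p. 189) and §9.4 (p. 188)] -/
theorem zetaBody_apply_deriv_zeta_add_conjMap_eq_tmul_deriv (hbody : ZetaBody W p f ι κ Λ c d a A z x)
    (k : ℕ) (r : (cyclotomicLevelsRat p (badPlaces c d A N)).Ideals)
    {ι' : Type*} (σ : ι' → absoluteGaloisGroup ℚ) (Nℓ : ι' → ℕ) (s : Finset ι') (comm)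
    {g : absoluteGaloisGroup ℚ} (hg : modNCyclotomicCharacter ℚ (cycLevel p k r.1) g = -1) :
    Λ k r.1 (s.noncommProd (fun ℓ => ∑ j ∈ Finset.range (Nℓ ℓ),
        (j : Module.End ℤ_[p] (H1 (tateRep W p) (cycSubgroup p k r.1))) *
          (conjMap (tateRep W p).toTopRep (cycSubgroup p k r.1) (σ ℓ) 1).hom.toLinearMap ^ j) comm
            (z k r) +
        conjMap (tateRep W p).toTopRep (cycSubgroup p k r.1) g 1
          (s.noncommProd (fun ℓ => ∑ j ∈ Finset.range (Nℓ ℓ),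
            (j : Module.End ℤ_[p] (H1 (tateRep W p) (cycSubgroup p k r.1))) *
              (conjMap (tateRep W p).toTopRep (cycSubgroup p k r.1) (σ ℓ) 1).hom.toLinearMap ^ j) comm
                (z k r))) =
      (1 : ℚ_[p]) ⊗ₜ[ℚ]
        (s.noncommProd (fun ℓ => ∑ j ∈ Finset.range (Nℓ ℓ),
            (j : Module.End ℚ (CyclotomicField (cycLevel p k r.1) ℚ)) *
              (sigma (cycLevel p k r.1) (modNCyclotomicCharacter ℚ (cycLevel p k r.1) (σ ℓ)) :
                CyclotomicField (cycLevel p k r.1) ℚ →ₐ[ℚ]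
                  CyclotomicField (cycLevel p k r.1) ℚ).toLinearMap ^ j)
            (pairwise_commute_fieldDeriv (cycLevel p k r.1)
              (fun ℓ => modNCyclotomicCharacter ℚ (cycLevel p k r.1) (σ ℓ)) Nℓ s)
          (x k r + sigma (cycLevel p k r.1) (-1) (x k r))) := by
  rw [zetaBody_apply_deriv_zeta_add_conjMap_eq_tmul W p f ι κ Λ c d a A z x hbody k r σ Nℓ s comm hg,
    sigma_fieldDeriv_comm, ← map_add]

end Zeta

end Summit.BirchSwinnertonDyer.Rank1Residual.GaloisImage.ZetaValue

end
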